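import Mathlib
import Summits.KontsevichZagierPeriods.Zeta5Search.TypeSpaceLawOriginFinal
import Summits.KontsevichZagierPeriods.Zeta5Search.ZeroWindowClasses
import Summits.KontsevichZagierPeriods.Zeta5Search.TypeEval
import HarnessLib

/-!
# ζ(5) search — the ORIGIN record windows reduce to a class structure plus finitely many rational identities

Cell `pub-zeta5` (HONEST FRAMING: systematic search; no irrationality claim unless certified), prover seat p3 generation 3.
Origin analogue of census g21's `ZeroWindowClasses.lean` for the two ORIGIN type-space-law windows `ResidueLaw.RecWindowM12 / M28`
(law `ResidueLaw.typeSpaceLawOrigin_holds`, p3 gen 2).  On an origin window the live classes of `b` are: DEEP classes (`E = −M`, centre-free,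
type list in `D`, `D` closed under reversal and NOT all palindromic), centre-free SUB-DEEP classes (`E = −M+1`, type list in `S`) and (for odd
`b₀`) odd-CENTRE sub-deep classes (self-conjugate, palindromic type list in `P`) — `OriginWindowClasses b p M D S P`.  Their doubled orbit
points are then, by the tree's level lemmas, the TYPE-LEVEL points `deepPt T = τ(T) + τ(T^rev)`, `ZeroWindows.pairPoint s = 2(σ(s) + σ(s^rev))`,
`ZeroWindows.deepPoint T = 2τ(T)` (`SecondOrder.tauW_level₀ / wHat_level₀ / live_pair`), and the exact first-order orbit vector of a deep class
is `dirVec T = σ(T) − σ(T^rev)`.  So the hypotheses of `TypeSpaceLawOrigin` (orbit vectors `∥ u`, all live points on ONE affine line of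
direction `u`) become FINITELY MANY RATIONAL IDENTITIES `LineData u c D S P` about `typeW/typeV/typeTauW/typeTauV` of explicit lists, decided
by the computable mirror `TypeEval.typeRho_eq_typeRhoC` (`decide +kernel`).  This file proves the reduction
`bound_of_classes : OriginWindowClasses ∧ LineData ⇒ v_p(Cas_j(b)) ≥ 5 − 2M`, states the two record windows' class structures
`RecOriginClassesM12 / M28` (census g21 §25.3 inventories; `@[conjecture]`, discharged by the atlas machine in `OriginWindowM12/M28*.lean`),
PROVES their line data (`lineData12`, `lineData28`: u = (5117040, −7747477) resp. (4124726376965498304000, −6258220956965489257777)) and the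
reductions `recWindowM12_of`, `recWindowM28_of`.  `p`-adic bookkeeping of rational numbers; nothing here bears on irrationality.
-/

noncomputable section

open Finset

namespace Summit.KontsevichZagierPeriods.Zeta5Search.OriginWindows

open Summit.KontsevichZagierPeriods.Zeta5Search.CasoratianValuation (InPolytope shift casoratian)
open Summit.KontsevichZagierPeriods.Zeta5Search.ClusterValuation
open Summit.KontsevichZagierPeriods.Zeta5Search.SecondOrder
open Summit.KontsevichZagierPeriods.Zeta5Search.ResidueLaw
open Summit.KontsevichZagierPeriods.Zeta5Search.LevelClass (typeW typeV)
open Summit.KontsevichZagierPeriods.Zeta5Search.CellKit (conj_level netExp_conj_level)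
open Summit.KontsevichZagierPeriods.Zeta5Search.ZeroWindows (deepPoint pairPoint deg_bRec)
open Summit.KontsevichZagierPeriods.Zeta5Search.TypeEval (typeRho_eq_typeRhoC)

variable {p : ℕ} [hp : Fact p.Prime]

/-! ## §1 Type-level data -/

/-- The functional `Φ_u(W, V) = u₁·V − u₂·W` (constant along a line of direction `u`). -/
def lineVal (u : ℤ × ℤ) (P : ℚ × ℚ) : ℚ := (u.1 : ℚ) * P.2 - (u.2 : ℚ) * P.1

/-- The doubled orbit point of a (possibly non-palindromic) deep type `T`: `τ(T) + τ(T^rev)`. -/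
def deepPt (T : List ℤ) : ℚ × ℚ :=
  (typeTauW (tTop T) (tList T) + typeTauW (tTop T) (fun k => tList T (tTop T - k)),
   typeTauV (tTop T) (tList T) + typeTauV (tTop T) (fun k => tList T (tTop T - k)))

/-- The exact first-order orbit vector of a deep type `T`: `σ(T) − σ(T^rev)`. -/
def dirVec (T : List ℤ) : ℚ × ℚ :=
  (typeW (tTop T) (tList T) - typeW (tTop T) (fun k => tList T (tTop T - k)),
   typeV (tTop T) (tList T) - typeV (tTop T) (fun k => tList T (tTop T - k)))

/-- **ORIGIN-WINDOW CLASS STRUCTURE**: (G1) every pole class has `E ≥ −M`; pole classes of exponent `−M` are centre-free with type list in `D`;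
pole classes of exponent `−M+1` are centre-free with type list in `S`, or (odd `b₀`) centre classes with type list in `P`. -/
def OriginWindowClasses (b : ℕ → ℤ) (p M : ℕ) (D S P : List (List ℤ)) : Prop :=
  (∀ x, x < p → 1 ≤ classPoleCount b p x → -(M : ℤ) ≤ classExp b p x) ∧
  (∀ x, x < p → 1 ≤ classPoleCount b p x → classExp b p x = -(M : ℤ) → ¬ CentreIn b p x ∧ classTypeList b p x ∈ D) ∧
  (∀ y, y < p → 1 ≤ classPoleCount b p y → classExp b p y = -(M : ℤ) + 1 →
      (¬ CentreIn b p y ∧ classTypeList b p y ∈ S) ∨ (¬ (2 : ℤ) ∣ b 0 ∧ CentreIn b p y ∧ classTypeList b p y ∈ P))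

/-- **LINE DATA** `(u, c)` for the type lists: every deep orbit vector is `∥ u` and every type-level point `Q` has `Φ_u(Q) = c`
(palindromicity of the centre types included). -/
def LineData (u : ℤ × ℤ) (c : ℚ) (D S P : List (List ℤ)) : Prop :=
  (∀ T ∈ D, lineVal u (dirVec T) = 0 ∧ lineVal u (deepPt T) = c) ∧
  (∀ s ∈ S, lineVal u (pairPoint s) = c) ∧
  (∀ T ∈ P, T.reverse = T ∧ lineVal u (deepPoint T) = c)

/-! ## §2 Every live point has `Φ_u = c` -/

section Points

variable (b : ℕ → ℤ) (hb : InPolytope b) (hpn : (p : ℤ) ≤ b 0) {M : ℕ} (hM : 6 ≤ M) {D S P : List (List ℤ)} {u : ℤ × ℤ} {c : ℚ}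
  (hC : OriginWindowClasses b p M D S P) (hI : LineData u c D S P)
include hb hpn hM hC hI

omit hM in
/-- **The exact orbit vector of a deep class is `∥ u`.** -/
theorem deep_dir {x : ℕ} (hx : x < p) (hpole : 1 ≤ classPoleCount b p x) (hE : classExp b p x = -(M : ℤ)) :
    ¬ CentreIn b p x ∧
      (u.1 : ℚ) * (vHat b p x - vHat b p (conjClass b p x)) - (u.2 : ℚ) * (wHat b p x - wHat b p (conjClass b p x)) = 0 := by
  have h0 : 0 ≤ b 0 := hb.1.1
  obtain ⟨hc, hTD⟩ := hC.2.1 x hx hpole hE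
  refine ⟨hc, ?_⟩
  have hxn : x ≤ (b 0).toNat := le_b0_of_lt b hpn hx
  obtain ⟨hL, hL'⟩ := level_bounds' (p := p) b hxn
  set T := classTypeList b p x with hTdef
  obtain ⟨htop, he⟩ := spec_of_typeList b hxn hTdef.symm
  obtain ⟨hx', hM2, hM2'⟩ := conj_level b hx hL hL'
  have hc0 : ¬ (¬ (2 : ℤ) ∣ b 0 ∧ CentreIn b p x) := fun h => hc h.2
  have hcc : ¬ CentreIn b p (conjClass b p x) := fun h => hc ((centreIn_conj_iff b h0 hxn).1 h)
  have hc0c : ¬ (¬ (2 : ℤ) ∣ b 0 ∧ CentreIn b p (conjClass b p x)) := fun h => hcc h.2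
  have hfc : ∀ k ≤ topLevel b p x, netExp b (conjClass b p x + k * p) = tList T (topLevel b p x - k) :=
    fun k hk => by rw [netExp_conj_level b hL hL' h0 hk]; exact he _ (Nat.sub_le _ _)
  have hw : wHat b p x = typeW (topLevel b p x) (tList T) := wHat_level₀ b hx hL hL' _ he hc0
  have hv : vHat b p x = typeV (topLevel b p x) (tList T) := vHat_level₀ b hx hL hL' _ he hc0
  have hwc : wHat b p (conjClass b p x) = typeW (topLevel b p x) (fun k => tList T (topLevel b p x - k)) :=
    wHat_level₀ b hx' hM2 hM2' _ hfc hc0c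
  have hvc : vHat b p (conjClass b p x) = typeV (topLevel b p x) (fun k => tList T (topLevel b p x - k)) :=
    vHat_level₀ b hx' hM2 hM2' _ hfc hc0c
  have key := (hI.1 T hTD).1
  simp only [lineVal, dirVec, htop] at key
  rw [hw, hv, hwc, hvc]
  linarith [key]

/-- **Every live point `Q` has `Φ_u(Q) = c`.** -/
theorem lineVal_live {z : ℕ} (hz : z ∈ liveClasses b p M) : lineVal u (pointW b p M z, pointV b p M z) = c := by
  have h0 : 0 ≤ b 0 := hb.1.1
  have hpnN : p ≤ (b 0).toNat := by omega
  obtain ⟨hzr, hpole, hE⟩ := mem_filter.1 hz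
  have hzp : z < p := mem_range.1 hzr
  have hzn : z ≤ (b 0).toNat := le_b0_of_lt b hpn hzp
  obtain ⟨hL, hL'⟩ := level_bounds' (p := p) b hzn
  set T := classTypeList b p z with hTdef
  obtain ⟨htop, he⟩ := spec_of_typeList b hzn hTdef.symm
  obtain ⟨hz', hM2, hM2'⟩ := conj_level b hzp hL hL'
  have hfc : ∀ k ≤ topLevel b p z, netExp b (conjClass b p z + k * p) = tList T (topLevel b p z - k) :=
    fun k hk => by rw [netExp_conj_level b hL hL' h0 hk]; exact he _ (Nat.sub_le _ _)
  rcases hE with hE | hE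
  · -- deep class: point `τ(T) + τ(T^rev)`
    obtain ⟨hc, hTD⟩ := hC.2.1 z hzp hpole hE
    have hc0 : ¬ (¬ (2 : ℤ) ∣ b 0 ∧ CentreIn b p z) := fun h => hc h.2
    have hcc : ¬ CentreIn b p (conjClass b p z) := fun h => hc ((centreIn_conj_iff b h0 hzn).1 h)
    have hc0c : ¬ (¬ (2 : ℤ) ∣ b 0 ∧ CentreIn b p (conjClass b p z)) := fun h => hcc h.2
    have htw : tauW b p z = typeTauW (topLevel b p z) (tList T) := tauW_level₀ b hzp hL hL' _ he hc0
    have htv : tauV b p z = typeTauV (topLevel b p z) (tList T) := tauV_level₀ b hzp hL hL' _ he hc0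
    have htwc : tauW b p (conjClass b p z) = typeTauW (topLevel b p z) (fun k => tList T (topLevel b p z - k)) :=
      tauW_level₀ b hz' hM2 hM2' _ hfc hc0c
    have htvc : tauV b p (conjClass b p z) = typeTauV (topLevel b p z) (fun k => tList T (topLevel b p z - k)) :=
      tauV_level₀ b hz' hM2 hM2' _ hfc hc0c
    have hPW : pointW b p M z = tauW b p z + tauW b p (conjClass b p z) := by unfold pointW; rw [if_pos hE]
    have hPV : pointV b p M z = tauV b p z + tauV b p (conjClass b p z) := by unfold pointV; rw [if_pos hE]
    have key := (hI.1 T hTD).2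
    simp only [lineVal, deepPt, htop] at key
    simp only [lineVal, hPW, hPV, htw, htv, htwc, htvc]
    linarith [key]
  · have hne : classExp b p z ≠ -(M : ℤ) := by omega
    rcases hC.2.2 z hzp hpole hE with ⟨hc, hTS⟩ | ⟨hodd, hcen, hTP⟩
    · -- centre-free sub-deep class: point `2(σ(T) + σ(T^rev))`
      have hc0 : ¬ (¬ (2 : ℤ) ∣ b 0 ∧ CentreIn b p z) := fun h => hc h.2
      have hcc : ¬ CentreIn b p (conjClass b p z) := fun h => hc ((centreIn_conj_iff b h0 hzn).1 h)
      have hc0c : ¬ (¬ (2 : ℤ) ∣ b 0 ∧ CentreIn b p (conjClass b p z)) := fun h => hcc h.2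
      have hw : wHat b p z = typeW (topLevel b p z) (tList T) := wHat_level₀ b hzp hL hL' _ he hc0
      have hv : vHat b p z = typeV (topLevel b p z) (tList T) := vHat_level₀ b hzp hL hL' _ he hc0
      have hwc : wHat b p (conjClass b p z) = typeW (topLevel b p z) (fun k => tList T (topLevel b p z - k)) :=
        wHat_level₀ b hz' hM2 hM2' _ hfc hc0c
      have hvc : vHat b p (conjClass b p z) = typeV (topLevel b p z) (fun k => tList T (topLevel b p z - k)) :=
        vHat_level₀ b hz' hM2 hM2' _ hfc hc0c
      have hPW : pointW b p M z = 2 * (wHat b p z + wHat b p (conjClass b p z)) := by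
        unfold pointW SecondOrder.orbitW; rw [if_neg hne, if_neg hc, if_neg hc]; rfl
      have hPV : pointV b p M z = 2 * (vHat b p z + vHat b p (conjClass b p z)) := by
        unfold pointV SecondOrder.orbitV; rw [if_neg hne, if_neg hc, if_neg hc]; rfl
      have key := hI.2.1 T hTS
      simp only [lineVal, pairPoint, htop] at key
      simp only [lineVal, hPW, hPV, hw, hv, hwc, hvc]
      linarith [key]
    · -- odd-centre sub-deep class: point `2τ(T)` by `live_pair`
      obtain ⟨hpal, key⟩ := hI.2.2 T hTP
      have hself : conjClass b p z = z := (centreIn_iff_conjClass_eq b hpnN hzp).1 hcen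
      have hneg : classExp b p z < 0 := by omega
      obtain ⟨hw, hv⟩ := live_pair b hb hpn hpal hzp hpole hneg (Or.inr ⟨hodd, hcen, hTdef.symm⟩)
      rw [hself] at hw hv
      have hPW : pointW b p M z = 4 * wHat b p z := by unfold pointW; rw [if_neg hne, if_pos hcen]
      have hPV : pointV b p M z = 4 * vHat b p z := by unfold pointV; rw [if_neg hne, if_pos hcen]
      have hw' : wHat b p z = typeTauW (tTop T) (tList T) / 2 := by linarith
      have hv' : vHat b p z = typeTauV (tTop T) (tList T) / 2 := by linarith
      simp only [lineVal, deepPoint] at key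
      simp only [lineVal, hPW, hPV, hw', hv']
      linarith [key]

end Points

/-! ## §3 The window bound from the class structure and the line data -/

/-- **`TypeSpaceLawOrigin` through `OriginWindowClasses` + `LineData`**: on the polytope with `5 ≤ p ≤ b₀ < p² − 2`, `M ≥ 6` even, DEG, a primitive
direction `u ≢ 0 (mod p)` with line data `(u, c)` for the window's type lists: `v_p(Cas_j(b)) ≥ 5 − 2M`. -/
theorem bound_of_classes (b : ℕ → ℤ) (j M : ℕ) (D S P : List (List ℤ)) (u : ℤ × ℤ) (c : ℚ) (hb : InPolytope b)
    (hbj : InPolytope (shift b j)) (hj1 : 1 ≤ j) (hj7 : j ≤ 7) (h5 : 5 ≤ p) (hpn : (p : ℤ) ≤ b 0) (hp2 : (b 0 + 2 : ℤ) < (p : ℤ) ^ 2)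
    (hM : 6 ≤ M) (hMe : Even M) (hu : ¬ ((p : ℤ) ∣ u.1 ∧ (p : ℤ) ∣ u.2))
    (hdeg : (p : ℤ) * ((M : ℤ) - 2) + ∑ x ∈ range p, classExp b p x ≤ -4)
    (hC : OriginWindowClasses b p M D S P) (hI : LineData u c D S P)
    (hne : casoratian b j ≠ 0) : (5 : ℤ) - 2 * M ≤ padicValRat p (casoratian b j) := by
  refine typeSpaceLawOrigin_holds b p j M u hb hbj hj1 hj7 hp.out h5 hpn hp2 hM hMe hu hC.1
    (fun x hx hpole hE => deep_dir b hb hpn hC hI hx hpole hE) hdeg (fun x hx y hy => Or.inl ?_) hne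
  have ex := lineVal_live b hb hpn hM hC hI hx
  have ey := lineVal_live b hb hpn hM hC hI hy
  simp only [lineVal] at ex ey
  unfold dirDet
  linarith

/-! ## §4 The record ray -/

/-- `(bRec n) 0 = 41 n`. -/
theorem bRec_zero_eq (n : ℕ) : bRec n 0 = 41 * (n : ℤ) := by
  simp [bRec, mul_comm]

/-- The generic origin-window reduction on the record ray. -/
theorem recWindow_of_classes (n p' M : ℕ) (D S P : List (List ℤ)) (u : ℤ × ℤ) (c : ℚ) (hn : 2 ≤ n) (hp' : p'.Prime) (h5 : 5 ≤ p')
    (hpn : p' ≤ 41 * n) (hp2 : 41 * n + 2 < p' ^ 2) (hM : 6 ≤ M) (hMe : Even M) (hdeg : (p' : ℤ) * ((M : ℤ) - 2) ≤ 50 * n + 1)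
    (hu : ¬ ((p' : ℤ) ∣ u.1 ∧ (p' : ℤ) ∣ u.2)) (hI : LineData u c D S P) (hC : OriginWindowClasses (bRec n) p' M D S P)
    (hne : casoratian (bRec n) 7 ≠ 0) : (5 : ℤ) - 2 * M ≤ padicValRat p' (casoratian (bRec n) 7) := by
  haveI : Fact p'.Prime := ⟨hp'⟩
  have hpb : (p' : ℤ) ≤ bRec n 0 := by rw [bRec_zero_eq]; exact_mod_cast hpn
  have hp2' : (bRec n 0 + 2 : ℤ) < (p' : ℤ) ^ 2 := by rw [bRec_zero_eq]; exact_mod_cast hp2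
  exact bound_of_classes (bRec n) 7 M D S P u c (inPolytope_bRec n) (inPolytope_shift_bRec n 7 (by omega) (by norm_num) (by norm_num))
    (by norm_num) (by norm_num) h5 hpb hp2' hM hMe hu (deg_bRec n M h5 hdeg) hC hI hne

end Summit.KontsevichZagierPeriods.Zeta5Search.OriginWindows

end
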